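import Literature.NumberTheory.Automorphic.UnitaryGroupAutomorphicRep
import Literature.NumberTheory.Automorphic.GLnFiniteAdeleRestrictedProduct
import Literature.NumberTheory.Automorphic.AdeleBaseChange
import Literature.Topology.Algebra.RestrictedProduct.Regroup
import Mathlib.Topology.Algebra.Group.Units
import HarnessLib

/-!
# The local factors `U(J)(F_v) ≤ Π_{w ∣ v} GL_N(E_w)` and `U(J)(𝒪_v)` of a unitary group
(Platonov–Rapinchuk, *Algebraic Groups and Number Theory* (1994), §5.1;
Cassels–Fröhlich, *Algebraic Number Theory* (1967), Ch. II §§10–11)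

Topic `NumberTheory/Automorphic`; namespace `Literature.NumberTheory.Automorphic` (grouping sub-namespaces
`GLn`, `UnitaryGroup`). Definitions and proved lemmas only: **no named facts, no `sorry`**.

**Setting** — exactly that of `UnitaryGroupAutomorphicRep`: `E/F` number fields, `c : E ≃ₐ[F] E`, `N : ℕ`,
`J ∈ M_N(E)` (any). That file constructs, for a finite place `v` of `F`, the local algebra
`E_v = E ⊗_F F_v := Π_{w ∣ v} E_w` (`UnitaryGroup.LocalRing`), the conjugation `c ⊗ 1` on it
(`UnitaryGroup.conjLocal`) and the LOCAL GROUP `U(J)(F_v) ≤ GL_N(E_v)` (`UnitaryGroup.«local»`), with the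
projection `U(J)(𝔸_F) →* U(J)(F_v)` (`UnitaryGroup.toLocal`). This file adds what is needed to see
`U(J)(F_v)` as a FACTOR OF A RESTRICTED PRODUCT over the places of `F` (file `UnitaryGroupRestrictedProduct`):

* `GLn.piEquiv : GL_n(Π_i R_i) ≃ₜ* Π_i GL_n(R_i)` (generic; Mathlib's `Matrix.piRingEquiv` upgraded to a
  `ContinuousMulEquiv`, then `ContinuousMulEquiv.piUnits`) and the matrix extensionality
  `Matrix.eq_iff_forall_map_evalRingHom` over product rings;
* `UnitaryGroup.localPi F E c N J v ≤ Π_{w ∣ v} GL_N(E_w)` — `U(J)(F_v)` transported along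
  `GL_N(Π_{w∣v} E_w) = Π_{w∣v} GL_N(E_w)`, with the **fibrewise membership criterion** `mem_localPi_iff`:
  `(u_w)_{w∣v} ∈ U(J)(F_v) ↔ ∀ w ∣ v, (c_* u_{c⁻¹ w})ᵀ · J · u_w = J` in `M_N(E_w)` (`c_* : E_{c⁻¹w} → E_w` the
  accepted `galAdicCompletionMap`), and `localPiEquiv : localPi ≃ₜ* «local»`; `isClosed_local`;
* `UnitaryGroup.localInt E c N J v = U(J)(F_v) ∩ Π_{w ∣ v} GL_N(𝒪_w)` — the integral points **`U(J)(𝒪_v)`**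
  (stabiliser of the standard lattice `Π_{w∣v} 𝒪_w^N = 𝓞_E^N ⊗ 𝒪_v`; Platonov–Rapinchuk §5.1, `G_{𝒪_v}`), a
  COMPACT OPEN subgroup of `U(J)(F_v)` (`isCompact_localInt`, `isOpen_localInt`, from the tree's
  `isCompact_glInt` / `isOpen_glInt` for the local fields `E_w`).

## Mathlib / tree

Mathlib: `Matrix.piRingEquiv`, `ContinuousMulEquiv.piUnits`, `Units.mapContinuousMulEquiv`,
`IsDedekindDomain.HeightOneSpectrum.under`. Nothing of Mathlib is duplicated (`GL_n` of a product ring as a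
product: absent — only the scalar `MulEquiv.piUnits`). Tree: `UnitaryGroupAutomorphicRep` (the setting),
`ReductiveGroupData` (`glInt`, `isOpen_glInt`, `isCompact_glInt`) with the local-field instances of
`AdicCompletionLocalField`, `RestrictedProduct/Regroup` (`Fib`, `fibSubgroup`, `finite_fib`), `AdeleBaseChange`
(`HeightOneSpectrum.tendsto_under_cofinite`: finitely many `w ∣ v`).

## Provenance

Written under the LEAN-IN-TREE rule (2026-08-18) for the pub-hodgecm formalisation cell (model-construction
sub-cell): the local factors of the finite-adelic unitary group `U(H)(𝔸_{L⁺,f})` of that cell's package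
(`HodgeCM/PerL34/AdelicUnitaryFactorisation.lean`, `Ufin L H`; CM case `F = L⁺`, `c` = complex conjugation).
Nothing in this file is a claim of the manuscripts adjudicated by that cell.

## References

* V. Platonov, A. Rapinchuk, *Algebraic Groups and Number Theory*, Academic Press (1994), §5.1 (adele groups
  of algebraic groups; the subgroups `G_{𝒪_v}`) [PlatonovRapinchuk1994].
* J. W. S. Cassels, A. Fröhlich (eds.), *Algebraic Number Theory*, Academic Press (1967), Ch. II §§10–11
  (`L ⊗_K K_v = ⊕_{w ∣ v} L_w`) [CasselsFrohlichANT1967].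
-/

set_option autoImplicit false

noncomputable section

open NumberField IsDedekindDomain Topology Filter
open scoped Matrix MatrixGroups

namespace Literature.NumberTheory.Automorphic

open Literature.Topology.Algebra.RestrictedProduct (Fib fibSubgroup mem_fibSubgroup_iff finite_fib isOpen_fibSubgroup)

/-! ## 1. `GL_n(Π_i R_i) ≃ₜ* Π_i GL_n(R_i)` -/

section PiGL

variable {ι : Type*} (R : ι → Type*) [∀ i, CommRing (R i)] [∀ i, TopologicalSpace (R i)]
variable (m : Type*) [Fintype m]

/-- Mathlib's `Matrix.piRingEquiv : M_m(Π_i R_i) ≃+* Π_i M_m(R_i)` is a homeomorphism (both sides carry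
product topologies; it only reorders coordinates). [folklore] -/
def Matrix.piContinuousMulEquiv : Matrix m m (Π i, R i) ≃ₜ* Π i, Matrix m m (R i) :=
  { (Matrix.piRingEquiv (β := R) (n := m)).toMulEquiv with
    continuous_toFun := continuous_pi fun i => continuous_id.matrix_map (continuous_apply i)
    continuous_invFun :=
      continuous_pi fun a => continuous_pi fun b => continuous_pi fun i =>
        ((continuous_apply b).comp ((continuous_apply a).comp (continuous_apply i))) }

/-- `Matrix.piContinuousMulEquiv` on entries (definitional). [folklore] -/
@[simp] theorem Matrix.piContinuousMulEquiv_apply (M : Matrix m m (Π i, R i)) (i : ι) :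
    Matrix.piContinuousMulEquiv R m M i = M.map (Pi.evalRingHom R i) := rfl

omit [∀ i, TopologicalSpace (R i)] [Fintype m] in
/-- Two matrices over `Π_i R_i` are equal iff their images in every `M_m(R_i)` are. [folklore] -/
theorem Matrix.eq_iff_forall_map_evalRingHom (M M' : Matrix m m (Π i, R i)) :
    M = M' ↔ ∀ i, M.map (Pi.evalRingHom R i) = M'.map (Pi.evalRingHom R i) := by
  constructor
  · rintro rfl i
    rfl
  · intro h
    exact Matrix.ext fun a b => funext fun i => congrFun (congrFun (h i) a) b

variable [DecidableEq m]

/-- **`GL_n(Π_i R_i) ≃ₜ* Π_i GL_n(R_i)`** as topological groups: a matrix over a product of rings is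
invertible iff all its components are (Mathlib `Units.mapContinuousMulEquiv` of `Matrix.piRingEquiv`, then
`ContinuousMulEquiv.piUnits`). [folklore] -/
def GLn.piEquiv : GL m (Π i, R i) ≃ₜ* Π i, GL m (R i) :=
  (Units.mapContinuousMulEquiv (Matrix.piContinuousMulEquiv R m)).trans ContinuousMulEquiv.piUnits

/-- Entries of the components of `GLn.piEquiv g`: `(g_{ab})_i`. [folklore] -/
@[simp] theorem GLn.coe_piEquiv_apply (g : GL m (Π i, R i)) (i : ι) :
    ((GLn.piEquiv R m g i : GL m (R i)) : Matrix m m (R i)) = (g : Matrix m m (Π i, R i)).map (Pi.evalRingHom R i) :=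
  rfl

/-- Entries of `GLn.piEquiv.symm u`: `(u_i)_{ab}`. [folklore] -/
@[simp] theorem GLn.coe_piEquiv_symm_apply (u : Π i, GL m (R i)) (a b : m) (i : ι) :
    (((GLn.piEquiv R m).symm u : GL m (Π i, R i)) : Matrix m m (Π i, R i)) a b i =
      ((u i : GL m (R i)) : Matrix m m (R i)) a b :=
  rfl

/-- `GLn.piEquiv.symm u` mapped to the `i`-th component is `u i`. [folklore] -/
theorem GLn.map_piEquiv_symm (u : Π i, GL m (R i)) (i : ι) :
    (((GLn.piEquiv R m).symm u : GL m (Π i, R i)) : Matrix m m (Π i, R i)).map (Pi.evalRingHom R i) =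
      ((u i : GL m (R i)) : Matrix m m (R i)) :=
  rfl

end PiGL

/-! ## 2. Places over `v`: the index map and finiteness -/

section Places

variable (F E : Type) [Field F] [NumberField F] [Field E] [NumberField E] [Algebra F E]

/-- The restriction of finite places `w ↦ w ∩ 𝓞 F` from `E` to `F` (Mathlib `HeightOneSpectrum.under`), as a
bare function — the index map along which `∏'_w GL_N(E_w)` is regrouped over the places of `F`; its fibre
`Fib (placesOver F E) v` is `UnitaryGroup.PlacesOver E v` (definitionally). [folklore] -/
abbrev placesOver : HeightOneSpectrum (𝓞 E) → HeightOneSpectrum (𝓞 F) := fun w => w.under (𝓞 F)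

example (v : HeightOneSpectrum (𝓞 F)) : Fib (placesOver F E) v = UnitaryGroup.PlacesOver E v := rfl

/-- Finitely many places of `E` lie over a given place of `F`: `w ↦ w ∩ 𝓞 F` tends to the cofinite filter
(the tree's `HeightOneSpectrum.tendsto_under_cofinite`). [folklore] -/
theorem tendsto_placesOver_cofinite : Tendsto (placesOver F E) cofinite cofinite :=
  HeightOneSpectrum.tendsto_under_cofinite (𝓞 F) (B := 𝓞 E)

/-- `Fact` form of `tendsto_placesOver_cofinite` (keys `RestrictedProduct.Regroup.fact_isOpen_fibSubgroup`). [folklore] -/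
instance fact_tendsto_placesOver_cofinite : Fact (Tendsto (placesOver F E) cofinite cofinite) :=
  ⟨tendsto_placesOver_cofinite F E⟩

/-- There are finitely many places of `E` above a place `v` of `F`. [folklore] -/
instance instFinitePlacesOver (v : HeightOneSpectrum (𝓞 F)) : Finite (UnitaryGroup.PlacesOver E v) :=
  finite_fib (placesOver F E) (tendsto_placesOver_cofinite F E) v

/-- (noncomputable) `Fintype` of the places above `v`. [folklore] -/
instance instFintypePlacesOver (v : HeightOneSpectrum (𝓞 F)) : Fintype (UnitaryGroup.PlacesOver E v) :=
  Fintype.ofFinite _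

/-- The `Fact` that the `GL_N(𝒪_w)` are open at every finite place `w` of `E` (keys Mathlib's topological-group
instance on `∏'_w [GL_N(E_w), GL_N(𝒪_w)]` and, regrouped, on `∏'_v [Π_{w∣v} GL_N(E_w), Π_{w∣v} GL_N(𝒪_w)]`).
[folklore] -/
instance fact_isOpen_glInt_adicCompletion (N : ℕ) :
    Fact (∀ w : HeightOneSpectrum (𝓞 E),
      IsOpen (glInt N (w.adicCompletion E) : Set (GL (Fin N) (w.adicCompletion E)))) :=
  ⟨fun w => isOpen_glInt N (w.adicCompletion E)⟩

end Places

namespace UnitaryGroup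

variable (F E : Type) [Field F] [NumberField F] [Field E] [NumberField E] [Algebra F E]
variable (c : E ≃ₐ[F] E) (N : ℕ) (J : Matrix (Fin N) (Fin N) E)

/-! ## 3. `U(J)(F_v)` is closed; the local form place by place -/

variable {F E} in
/-- `c⁻¹ w`, as a place over the same `v` as `w` (`under_inv_smul_eq`). [folklore] -/
abbrev PlacesOver.galInv {v : HeightOneSpectrum (𝓞 F)} (w : PlacesOver E v) : PlacesOver E v :=
  ⟨c⁻¹ • w.1, under_inv_smul_eq c w⟩

variable {F} in
/-- `c ⊗ 1` on `E_v` is continuous. [folklore] -/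
theorem continuous_conjLocal (v : HeightOneSpectrum (𝓞 F)) : Continuous (conjLocal E c v) :=
  continuous_pi fun w =>
    (continuous_galAdicCompletionMap E c (smul_inv_smul c w.1)).comp (continuous_apply _)

variable {F} in
/-- **`U(J)(F_v)` is closed in `GL_N(E_v)`** (a level set of a continuous map). [folklore] -/
theorem isClosed_local (v : HeightOneSpectrum (𝓞 F)) :
    IsClosed («local» E c N J v : Set (GL (Fin N) (LocalRing E v))) := by
  have h1 : Continuous fun g : GL (Fin N) (LocalRing E v) => (g : Matrix (Fin N) (Fin N) (LocalRing E v)) :=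
    Units.continuous_val
  have hc : Continuous fun g : GL (Fin N) (LocalRing E v) =>
      ((g : Matrix (Fin N) (Fin N) (LocalRing E v)).map (conjLocal E c v))ᵀ *
        (adelicForm E N J).map (adeleToLocal E v) * (g : Matrix (Fin N) (Fin N) (LocalRing E v)) :=
    ((h1.matrix_map (continuous_conjLocal E c v)).matrix_transpose.mul continuous_const).mul h1
  exact isClosed_eq hc continuous_const

variable {E N} in
/-- `J` viewed over the completion `E_w`. [folklore] -/
abbrev placeForm (w : HeightOneSpectrum (𝓞 E)) : Matrix (Fin N) (Fin N) (w.adicCompletion E) :=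
  J.map (algebraMap E (w.adicCompletion E))

variable {F} in
omit [NumberField F] in
/-- The `w`-component of the local form `J ⊗ 1 ∈ M_N(E_v)` is `J ∈ M_N(E_w)`. [folklore] -/
theorem localForm_map_eval (v : HeightOneSpectrum (𝓞 F)) (w : PlacesOver E v) :
    ((adelicForm E N J).map (adeleToLocal E v)).map
        (Pi.evalRingHom (fun w : PlacesOver E v => w.1.adicCompletion E) w) = placeForm J w.1 := by
  rw [adelicForm, Matrix.map_map, Matrix.map_map]
  rfl

/-! ## 4. The factor form `U(J)(F_v) ≤ Π_{w ∣ v} GL_N(E_w)` and its fibrewise membership criterion -/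

variable {F} in
/-- `Π_{w ∣ v} GL_N(E_w)`. [folklore] -/
abbrev LocalGLPi (v : HeightOneSpectrum (𝓞 F)) : Type :=
  Π w : PlacesOver E v, GL (Fin N) (w.1.adicCompletion E)

variable {F} in
/-- `GL_N(E_v) = GL_N(Π_{w∣v} E_w) ≃ₜ* Π_{w ∣ v} GL_N(E_w)` (`GLn.piEquiv` at the places over `v`). [folklore] -/
abbrev localGLPiEquiv (v : HeightOneSpectrum (𝓞 F)) : GL (Fin N) (LocalRing E v) ≃ₜ* LocalGLPi E N v :=
  GLn.piEquiv (fun w : PlacesOver E v => w.1.adicCompletion E) (Fin N)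

variable {F} in
/-- **`U(J)(F_v)` as a subgroup of `Π_{w ∣ v} GL_N(E_w)`** (transport of `UnitaryGroup.«local»` along
`GL_N(Π_w E_w) = Π_w GL_N(E_w)`): the form in which it is a factor of `U(J)(𝔸_{F,f}) = ∏'_v U(J)(F_v)`.
[cite: PlatonovRapinchuk1994, §5.1] -/
def localPi (v : HeightOneSpectrum (𝓞 F)) : Subgroup (LocalGLPi E N v) :=
  («local» E c N J v).comap (localGLPiEquiv E N v).symm.toMulEquiv.toMonoidHom

variable {F} in
/-- Membership in `localPi` is membership of the regrouped matrix in `U(J)(F_v)` (definitional). [folklore] -/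
theorem mem_localPi_iff_symm_mem (v : HeightOneSpectrum (𝓞 F)) (u : LocalGLPi E N v) :
    u ∈ localPi E c N J v ↔ (localGLPiEquiv E N v).symm u ∈ «local» E c N J v :=
  Iff.rfl

variable {F} in
/-- `GLn.piEquiv g ∈ localPi ↔ g ∈ U(J)(F_v)`. [folklore] -/
theorem localGLPiEquiv_mem_localPi_iff (v : HeightOneSpectrum (𝓞 F)) (g : GL (Fin N) (LocalRing E v)) :
    localGLPiEquiv E N v g ∈ localPi E c N J v ↔ g ∈ «local» E c N J v := by
  rw [mem_localPi_iff_symm_mem, ContinuousMulEquiv.symm_apply_apply]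

variable {F} in
/-- **Fibrewise membership criterion.** `u = (u_w)_{w ∣ v} ∈ Π_w GL_N(E_w)` lies in `U(J)(F_v)` iff for
every `w ∣ v`: `(c_* u_{c⁻¹ w})ᵀ · J · u_w = J` in `M_N(E_w)`, where `c_* : E_{c⁻¹ w} →+* E_w` is the continuous
extension of `c` (`galAdicCompletionMap`). For `v` inert (`c w = w`) this is the unitary condition in
`GL_N(E_w)`; for `v` split (`c` swaps the two `w ∣ v`) it ties `u_{w}` to `u_{c w}`. [folklore] -/
theorem mem_localPi_iff (v : HeightOneSpectrum (𝓞 F)) (u : LocalGLPi E N v) :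
    u ∈ localPi E c N J v ↔ ∀ w : PlacesOver E v,
      (((u (PlacesOver.galInv c w) : GL (Fin N) ((PlacesOver.galInv c w).1.adicCompletion E)) :
            Matrix (Fin N) (Fin N) ((PlacesOver.galInv c w).1.adicCompletion E)).map
          (galAdicCompletionMap c (smul_inv_smul c w.1)))ᵀ * placeForm J w.1 *
        ((u w : GL (Fin N) (w.1.adicCompletion E)) : Matrix (Fin N) (Fin N) (w.1.adicCompletion E)) =
        placeForm J w.1 := by
  rw [mem_localPi_iff_symm_mem, «local», mem_unitaryGroupOfForm_iff]
  -- an identity of matrices over `Π_w E_w` holds iff it holds after evaluation at every `w`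
  set M : Matrix (Fin N) (Fin N) (LocalRing E v) :=
    (((localGLPiEquiv E N v).symm u : GL (Fin N) (LocalRing E v)) : Matrix (Fin N) (Fin N) (LocalRing E v))
  have hev : ∀ w : PlacesOver E v,
      M.map (Pi.evalRingHom (fun w : PlacesOver E v => w.1.adicCompletion E) w) =
        ((u w : GL (Fin N) (w.1.adicCompletion E)) : Matrix (Fin N) (Fin N) (w.1.adicCompletion E)) :=
    fun w => GLn.map_piEquiv_symm _ _ u w
  have hconj : ∀ w : PlacesOver E v,
      (M.map (conjLocal E c v)).map (Pi.evalRingHom (fun w : PlacesOver E v => w.1.adicCompletion E) w) =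
        (((u (PlacesOver.galInv c w) : GL (Fin N) ((PlacesOver.galInv c w).1.adicCompletion E)) :
            Matrix (Fin N) (Fin N) ((PlacesOver.galInv c w).1.adicCompletion E)).map
          (galAdicCompletionMap c (smul_inv_smul c w.1))) := by
    intro w
    rw [← hev (PlacesOver.galInv c w), Matrix.map_map, Matrix.map_map]
    rfl
  have hlhs : ∀ w : PlacesOver E v,
      ((M.map (conjLocal E c v))ᵀ * (adelicForm E N J).map (adeleToLocal E v) * M).map
          (Pi.evalRingHom (fun w : PlacesOver E v => w.1.adicCompletion E) w) =
        (((u (PlacesOver.galInv c w) : GL (Fin N) ((PlacesOver.galInv c w).1.adicCompletion E)) :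
              Matrix (Fin N) (Fin N) ((PlacesOver.galInv c w).1.adicCompletion E)).map
            (galAdicCompletionMap c (smul_inv_smul c w.1)))ᵀ * placeForm J w.1 *
          ((u w : GL (Fin N) (w.1.adicCompletion E)) : Matrix (Fin N) (Fin N) (w.1.adicCompletion E)) := by
    intro w
    rw [← RingHom.mapMatrix_apply, map_mul, map_mul, RingHom.mapMatrix_apply, RingHom.mapMatrix_apply,
      RingHom.mapMatrix_apply, Matrix.transpose_map, hconj, hev, localForm_map_eval]
  rw [Matrix.eq_iff_forall_map_evalRingHom]
  refine forall_congr' fun w => ?_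
  rw [hlhs, localForm_map_eval]

variable {F} in
/-- `localPi` is closed in `Π_{w ∣ v} GL_N(E_w)`. [folklore] -/
theorem isClosed_localPi (v : HeightOneSpectrum (𝓞 F)) : IsClosed (localPi E c N J v : Set (LocalGLPi E N v)) :=
  (isClosed_local E c N J v).preimage (localGLPiEquiv E N v).symm.continuous

variable {F} in
/-- **`U(J)(F_v)` in its two forms**: `localPi … v ≃ₜ* «local» … v` (restriction of
`GL_N(Π_w E_w) = Π_w GL_N(E_w)`). [folklore] -/
def localPiEquiv (v : HeightOneSpectrum (𝓞 F)) : localPi E c N J v ≃ₜ* «local» E c N J v where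
  toFun u := ⟨(localGLPiEquiv E N v).symm u.1, u.2⟩
  invFun g := ⟨localGLPiEquiv E N v g.1, (localGLPiEquiv_mem_localPi_iff E c N J v g.1).2 g.2⟩
  left_inv u := Subtype.ext ((localGLPiEquiv E N v).apply_symm_apply u.1)
  right_inv g := Subtype.ext ((localGLPiEquiv E N v).symm_apply_apply g.1)
  map_mul' _ _ := Subtype.ext (map_mul _ _ _)
  continuous_toFun := ((localGLPiEquiv E N v).symm.continuous.comp continuous_subtype_val).subtype_mk _
  continuous_invFun := ((localGLPiEquiv E N v).continuous.comp continuous_subtype_val).subtype_mk _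

variable {F} in
/-- Underlying matrices: `localPiEquiv u = GLn.piEquiv.symm u`. [folklore] -/
@[simp] theorem coe_localPiEquiv_apply (v : HeightOneSpectrum (𝓞 F)) (u : localPi E c N J v) :
    ((localPiEquiv E c N J v u : «local» E c N J v) : GL (Fin N) (LocalRing E v)) =
      (localGLPiEquiv E N v).symm u.1 := rfl

variable {F} in
/-- Underlying tuples: `localPiEquiv.symm g = GLn.piEquiv g`. [folklore] -/
@[simp] theorem coe_localPiEquiv_symm_apply (v : HeightOneSpectrum (𝓞 F)) (g : «local» E c N J v) :
    (((localPiEquiv E c N J v).symm g : localPi E c N J v) : LocalGLPi E N v) =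
      localGLPiEquiv E N v g.1 := rfl

/-! ## 5. Integral points `U(J)(𝒪_v)` — a compact open subgroup of `U(J)(F_v)` -/

variable {F} in
/-- The box `Π_{w ∣ v} GL_N(𝒪_w) ≤ Π_{w ∣ v} GL_N(E_w)` (the fibre box `fibSubgroup` of the `GL_N(𝒪_w)` over `v`).
[folklore] -/
abbrev localIntBox (v : HeightOneSpectrum (𝓞 F)) : Subgroup (LocalGLPi E N v) :=
  fibSubgroup (fun w : HeightOneSpectrum (𝓞 E) => glInt N (w.adicCompletion E)) (placesOver F E) v

variable {F} in
/-- **The integral points `U(J)(𝒪_v) := U(J)(F_v) ∩ Π_{w ∣ v} GL_N(𝒪_w)`** — the stabiliser in `U(J)(F_v)` of the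
standard lattice `Π_{w ∣ v} 𝒪_w^N = 𝓞_E^N ⊗_{𝓞_F} 𝒪_v` of `E_v^N`; Platonov–Rapinchuk §5.1 (`G_{𝒪_v}` for a fixed
matrix realisation). As a subgroup of `localPi … v`. [cite: PlatonovRapinchuk1994, §5.1] -/
abbrev localInt (v : HeightOneSpectrum (𝓞 F)) : Subgroup (localPi E c N J v) :=
  (localIntBox E N v).subgroupOf (localPi E c N J v)

variable {F} in
/-- Membership in `U(J)(𝒪_v)`: every component `u_w ∈ GL_N(𝒪_w)`. [folklore] -/
theorem mem_localInt_iff (v : HeightOneSpectrum (𝓞 F)) (u : localPi E c N J v) :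
    u ∈ localInt E c N J v ↔ ∀ w : PlacesOver E v, (u : LocalGLPi E N v) w ∈ glInt N (w.1.adicCompletion E) := by
  rw [Subgroup.mem_subgroupOf]
  exact mem_fibSubgroup_iff _ _ _

variable {F} in
/-- The box `Π_{w ∣ v} GL_N(𝒪_w)` is open. [folklore] -/
theorem isOpen_localIntBox (v : HeightOneSpectrum (𝓞 F)) : IsOpen (localIntBox E N v : Set (LocalGLPi E N v)) :=
  isOpen_fibSubgroup _ _ (fun w => isOpen_glInt N (w.adicCompletion E)) (tendsto_placesOver_cofinite F E) v

/-- `Fact` form of `isOpen_localIntBox` (keys Mathlib's topological-group instance on the restricted product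
`∏'_v [Π_{w∣v} GL_N(E_w), Π_{w∣v} GL_N(𝒪_w)]` and `RestrictedProduct/Cutout.fact_isOpen_inH`). [folklore] -/
instance fact_isOpen_localIntBox :
    Fact (∀ v : HeightOneSpectrum (𝓞 F), IsOpen (localIntBox E N v : Set (LocalGLPi E N v))) :=
  ⟨fun v => isOpen_localIntBox E N v⟩

variable {F} in
omit [NumberField F] in
/-- The box `Π_{w ∣ v} GL_N(𝒪_w)` is compact (a product of the compact groups `GL_N(𝒪_w)`, `isCompact_glInt`).
[folklore] -/
theorem isCompact_localIntBox (v : HeightOneSpectrum (𝓞 F)) :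
    IsCompact (localIntBox E N v : Set (LocalGLPi E N v)) := by
  have h : (localIntBox E N v : Set (LocalGLPi E N v)) =
      Set.pi Set.univ fun w : PlacesOver E v =>
        (glInt N (w.1.adicCompletion E) : Set (GL (Fin N) (w.1.adicCompletion E))) := by
    ext x
    simp [mem_fibSubgroup_iff]
  rw [h]
  exact isCompact_univ_pi fun w => isCompact_glInt N (w.1.adicCompletion E)

variable {F} in
/-- **`U(J)(𝒪_v)` is open in `U(J)(F_v)`.** [cite: PlatonovRapinchuk1994, §5.1] -/
theorem isOpen_localInt (v : HeightOneSpectrum (𝓞 F)) :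
    IsOpen (localInt E c N J v : Set (localPi E c N J v)) :=
  (isOpen_localIntBox E N v).preimage continuous_subtype_val

/-- `Fact` form of `isOpen_localInt` (keys Mathlib's topological-group instance on
`∏'_v [U(J)(F_v), U(J)(𝒪_v)]`). [folklore] -/
instance fact_isOpen_localInt :
    Fact (∀ v : HeightOneSpectrum (𝓞 F), IsOpen (localInt E c N J v : Set (localPi E c N J v))) :=
  ⟨fun v => isOpen_localInt E c N J v⟩

variable {F} in
/-- **`U(J)(𝒪_v)` is compact.** [cite: PlatonovRapinchuk1994, §5.1] -/
theorem isCompact_localInt (v : HeightOneSpectrum (𝓞 F)) :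
    IsCompact (localInt E c N J v : Set (localPi E c N J v)) :=
  (isClosed_localPi E c N J v).isClosedEmbedding_subtypeVal.isCompact_preimage (isCompact_localIntBox E N v)

end UnitaryGroup

end Literature.NumberTheory.Automorphic

end
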